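import Mathlib.CategoryTheory.Galois.Basic
import Mathlib.CategoryTheory.Adjunction.Limits
import Mathlib.CategoryTheory.Limits.Preserves.Shapes.BinaryProducts
import HarnessLib

/-!
# Galois categories are stable under equivalence of categories

Mathlib-level lemma for the anabelioid dictionary (`Literature.AnabelianGeometry.Anabelioids`):
if `C` is a Galois category (Mathlib `GaloisCategory`, conditions (G1)–(G6) of
[SGA1, Exp. V §4]) and `e : C ≌ D` is an equivalence of categories, then `D` is a Galois category
(`galoisCategory_of_equivalence`), and for every fibre functor `F` of `C` the composite
`e.inverse ⋙ F` is a fibre functor of `D` (`nonempty_fiberFunctor_inverse_comp`); conditions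
(G1)–(G3) alone also transport (`preGaloisCategory_of_equivalence`).  Everything is formal: an
equivalence creates all (co)limits, preserves and reflects monomorphisms, epimorphisms and
isomorphisms; the only bookkeeping is (G3) (a monomorphism is a direct summand), moved across the
counit isomorphism, and the universe of the finite groups in (G2)/(G5), handled by Mathlib's
"quotients by finite groups in arbitrary universes" instances.

Consumers (abc-iut layer L3/§2 of [SemiAnbd]): slices `C/P ≌ B(U)` of a connected anabelioid over a
connected object (finite étale coverings, [SemiAnbd] p. 23), image anabelioids.  Deliberately NOT
here: any specific equivalence.
-/

namespace Literature.AnabelianGeometry.Anabelioids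

open CategoryTheory CategoryTheory.Limits CategoryTheory.PreGaloisCategory

universe w v₁ v₂ u₁ u₂

variable {C : Type u₁} [Category.{v₁} C] {D : Type u₂} [Category.{v₂} D]

/-- Conditions (G1)–(G3) transport along an equivalence of categories: terminal object, pullbacks,
finite coproducts and quotients by finite groups exist in `D` because they exist in `C ≌ D`, and a
monomorphism of `D` is a direct summand because its image in `C` is.
[cite: SGA1, Exp. V §4 (conditions (G1)–(G3))] -/
theorem preGaloisCategory_of_equivalence [PreGaloisCategory C] (e : C ≌ D) :
    PreGaloisCategory D where
  hasTerminal := Adjunction.hasLimitsOfShape_of_equivalence e.inverse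
  hasPullbacks := Adjunction.hasLimitsOfShape_of_equivalence e.inverse
  hasFiniteCoproducts := ⟨fun _ => Adjunction.hasColimitsOfShape_of_equivalence e.inverse⟩
  hasQuotientsByFiniteGroups _ _ _ := Adjunction.hasColimitsOfShape_of_equivalence e.inverse
  monoInducesIsoOnDirectSummand {X Y} i _ := by
    obtain ⟨Z, u, ⟨hc⟩⟩ := PreGaloisCategory.monoInducesIsoOnDirectSummand (e.inverse.map i)
    -- move the colimit cofan to `D` and across the counit isomorphism
    set εX : e.functor.obj (e.inverse.obj X) ≅ X := e.counitIso.app X with hεX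
    set εY : e.functor.obj (e.inverse.obj Y) ≅ Y := e.counitIso.app Y with hεY
    have h1 : IsColimit (BinaryCofan.mk (e.functor.map (e.inverse.map i)) (e.functor.map u)) :=
      mapIsColimitOfPreservesOfIsColimit e.functor _ _ hc
    have h2 : IsColimit (BinaryCofan.mk (εX.hom ≫ i) (e.functor.map u ≫ εY.hom)) := by
      refine IsColimit.ofIsoColimit h1 (BinaryCofan.ext εY ?_ rfl)
      exact e.counit.naturality i
    have h3 := BinaryCofan.isColimitCompLeftIso _ εX.inv h2
    have h4 : εX.inv ≫ (BinaryCofan.mk (εX.hom ≫ i) (e.functor.map u ≫ εY.hom)).inl = i :=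
      εX.inv_hom_id_assoc i
    rw [h4] at h3
    exact ⟨e.functor.obj Z, e.functor.map u ≫ εY.hom, ⟨h3⟩⟩

/-- Conditions (G4)–(G6) transport: if `F` is a fibre functor of `C` and `e : C ≌ D`, then
`e.inverse ⋙ F` is a fibre functor of `D` (for the transported (G1)–(G3)).
[cite: SGA1, Exp. V §4 (conditions (G4)–(G6))] -/
theorem nonempty_fiberFunctor_inverse_comp [PreGaloisCategory C] (e : C ≌ D)
    (F : C ⥤ FintypeCat.{w}) [FiberFunctor F] :
    letI : PreGaloisCategory D := preGaloisCategory_of_equivalence e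
    Nonempty (FiberFunctor (e.inverse ⋙ F)) := by
  letI : PreGaloisCategory D := preGaloisCategory_of_equivalence e
  exact ⟨{ preservesTerminalObjects := inferInstance
           preservesPullbacks := inferInstance
           preservesFiniteCoproducts := ⟨fun _ => inferInstance⟩
           preservesEpis := inferInstance
           preservesQuotientsByFiniteGroups := fun _ _ _ => inferInstance
           reflectsIsos := inferInstance }⟩

/-- **A category equivalent to a Galois category is a Galois category** ((G1)–(G6) of
[SGA1, Exp. V §4] are invariant under equivalence): the fibre functor of `D` is `e.inverse ⋙ F`
composed with Mathlib's universe switch of `FintypeCat`.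
[cite: SGA1, Exp. V §4 (conditions (G1)–(G6))] -/
theorem galoisCategory_of_equivalence [GaloisCategory C] (e : C ≌ D) : GaloisCategory D := by
  letI : PreGaloisCategory D := preGaloisCategory_of_equivalence e
  obtain ⟨F, ⟨hF⟩⟩ := GaloisCategory.hasFiberFunctor (C := C)
  obtain ⟨hF'⟩ := nonempty_fiberFunctor_inverse_comp e F
  haveI := hF'
  have hF'' : FiberFunctor ((e.inverse ⋙ F) ⋙ FintypeCat.uSwitch.{v₁, v₂}) :=
    FiberFunctor.comp_right _
  exact { hasFiberFunctor := ⟨(e.inverse ⋙ F) ⋙ FintypeCat.uSwitch.{v₁, v₂}, ⟨hF''⟩⟩ }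

/-- Along an equivalence, `e.inverse ⋙ F` is a fibre functor of the (Galois) category `D`, for the
Galois structure of `galoisCategory_of_equivalence` — the form consumed when a basepoint of `C`
is to be read as a basepoint of `D`. [cite: SGA1, Exp. V §4 (conditions (G4)–(G6))] -/
theorem nonempty_fiberFunctor_inverse_comp' [GaloisCategory C] (e : C ≌ D)
    (F : C ⥤ FintypeCat.{w}) [FiberFunctor F] :
    letI : GaloisCategory D := galoisCategory_of_equivalence e
    Nonempty (FiberFunctor (e.inverse ⋙ F)) :=
  nonempty_fiberFunctor_inverse_comp e F

end Literature.AnabelianGeometry.Anabelioids
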